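import Literature.Probability.RandomPlanarGeometry.BrownianBridgeDecomposition
import HarnessLib

/-!
# Splitting the Brownian bridge at a fixed time: two independent bridges through the midpoint

The Markov property of the Brownian bridge (Lawler, *Conformally Invariant Processes in the
Plane* (2005), §5.2: the Chapman–Kolmogorov equation for the bridge/loop path measures,
"`μ_D(z, w; s + t) = ∫_D [μ_D(z, z'; s) ⊕ μ_D(z', w; t)] dA(z')`"), in its normalised Gaussian
form for the unit bridge `β_v = B_v − v B_1`: for a fixed `u ∈ [0, 1]`, the re-bridged pieces

  `A_v = β_{uv} − v β_u`  (the part before time `u`, pinned at both ends, time-rescaled to `[0,1]`),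
  `C_v = β_{u + (1−u)v} − (1 − v) β_u`  (the part after time `u`, likewise),

and the value `β_u` at the splitting time are mutually independent, and `A`, `C` are Brownian
bridges of variances `u` and `1 − u`: `Cov(A_v, A_{v'}) = u (v ∧ v' − vv')`,
`Cov(C_v, C_{v'}) = (1 − u)(v ∧ v' − vv')`. Everything is a computation with the bridge
covariance `Cov(β_a, β_b) = a ∧ b − ab` (`covariance_bridge₁`, file `BrownianBridgeShift`) and
Kallenberg's Lemma 13.1 (jointly Gaussian and uncorrelated ⇒ independent; equal covariances ⇒
equal laws).

* `BrownianLoop.splitFst u ω v`, `BrownianLoop.splitSnd u ω v` — the pieces `A_v`, `C_v`;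
* `covariance_splitFst`, `covariance_splitSnd`, `covariance_splitFst_splitSnd`,
  `covariance_splitFst_bridge₁`, `covariance_splitSnd_bridge₁` — the covariances;
* `map_splitFst`, `map_splitSnd` — `A` has the law of `√u β`, `C` the law of `√(1−u) β`;
* `indepFun_splitFst_splitSnd_bridge₁`, `indepFun_splitSnd_bridge₁` — `A ⟂ (C, β_u)` and
  `C ⟂ β_u` (hence `A, C, β_u` are mutually independent).

## References

* G. F. Lawler, *Conformally Invariant Processes in the Plane*, AMS (2005), §5.2
  (Chapman–Kolmogorov for `μ(z, w; t)`).
* O. Kallenberg, *Foundations of Modern Probability* (2nd ed., 2002), Ch. 13, Lemma 13.1.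
* D. Revuz, M. Yor, *Continuous Martingales and Brownian Motion* (1999), Ch. I, Ex. (3.10)
  (Brownian bridge).
-/

noncomputable section

open Set MeasureTheory ProbabilityTheory unitInterval
open scoped unitInterval NNReal ENNReal

namespace Literature.Probability.RandomPlanarGeometry

open Literature.Probability.Process (WienerPair wienerPair brownian measurable_brownian
  preWienerMeasure)

namespace BrownianLoop

/-! ### The splitting times and the two pieces -/

/-- The time `uv ∈ [0, 1]` (the piece before `u`, rescaled). [folklore] -/
def fstTime (u v : I) : I := ⟨(u : ℝ) * v, mul_mem u.2 v.2⟩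

/-- The time `u + (1 − u)v ∈ [0, 1]` (the piece after `u`, rescaled). [folklore] -/
def sndTime (u v : I) : I := σ (fstTime (σ u) (σ v))

/-- Coordinates of `fstTime`. [folklore] -/
@[simp] theorem coe_fstTime (u v : I) : (fstTime u v : ℝ) = u * v := rfl

/-- Coordinates of `sndTime`: `u + (1 − u) v`. [folklore] -/
@[simp] theorem coe_sndTime (u v : I) : (sndTime u v : ℝ) = u + (1 - u) * v := by
  simp only [sndTime, coe_symm_eq, coe_fstTime]
  ring

/-- **The first piece, re-bridged**: `A_v = β_{uv} − v β_u`. [folklore] -/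
def splitFst (u : I) (ω : ℝ≥0 → ℝ) (v : I) : ℝ := bridge₁ ω (fstTime u v) - (v : ℝ) * bridge₁ ω u

/-- **The second piece, re-bridged**: `C_v = β_{u+(1−u)v} − (1 − v) β_u`. [folklore] -/
def splitSnd (u : I) (ω : ℝ≥0 → ℝ) (v : I) : ℝ :=
  bridge₁ ω (sndTime u v) - (1 - (v : ℝ)) * bridge₁ ω u

/-- Measurability of the first piece. [folklore] -/
@[fun_prop] theorem measurable_splitFst (u v : I) : Measurable fun ω ↦ splitFst u ω v := by
  unfold splitFst; fun_prop

/-- Measurability of the second piece. [folklore] -/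
@[fun_prop] theorem measurable_splitSnd (u v : I) : Measurable fun ω ↦ splitSnd u ω v := by
  unfold splitSnd; fun_prop

/-- Square integrability of the first piece. [folklore] -/
theorem memLp_two_splitFst (u v : I) : MemLp (fun ω ↦ splitFst u ω v) 2 preWienerMeasure :=
  (memLp_two_bridge₁ _).sub ((memLp_two_bridge₁ u).const_mul _)

/-- Square integrability of the second piece. [folklore] -/
theorem memLp_two_splitSnd (u v : I) : MemLp (fun ω ↦ splitSnd u ω v) 2 preWienerMeasure :=
  (memLp_two_bridge₁ _).sub ((memLp_two_bridge₁ u).const_mul _)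

/-! ### Covariances -/

section Covariance

variable (u : I)

/-- `Cov(β_{uv}, β_{uv'}) = u (v ∧ v') − u² vv'`. [folklore] -/
theorem covariance_bridge₁_fstTime (v v' : I) :
    cov[fun ω ↦ bridge₁ ω (fstTime u v), fun ω ↦ bridge₁ ω (fstTime u v'); preWienerMeasure] =
      (u : ℝ) * min (v : ℝ) v' - (u : ℝ) ^ 2 * v * v' := by
  rw [covariance_bridge₁, coe_fstTime, coe_fstTime, ← mul_min_of_nonneg _ _ u.2.1]
  ring

/-- `Cov(β_{uv}, β_u) = uv − u² v`. [folklore] -/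
theorem covariance_bridge₁_fstTime_self (v : I) :
    cov[fun ω ↦ bridge₁ ω (fstTime u v), fun ω ↦ bridge₁ ω u; preWienerMeasure] =
      (u : ℝ) * v - (u : ℝ) ^ 2 * v := by
  rw [covariance_bridge₁, coe_fstTime, min_eq_left (mul_le_of_le_one_right u.2.1 v.2.2)]
  ring

/-- `Cov(β_u, β_{uv}) = uv − u² v`. [folklore] -/
theorem covariance_bridge₁_self_fstTime (v : I) :
    cov[fun ω ↦ bridge₁ ω u, fun ω ↦ bridge₁ ω (fstTime u v); preWienerMeasure] =
      (u : ℝ) * v - (u : ℝ) ^ 2 * v := by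
  haveI := isProbabilityMeasure_preWienerMeasure'
  rw [covariance_comm, covariance_bridge₁_fstTime_self]

/-- `Cov(β_u, β_u) = u − u²`. [folklore] -/
theorem covariance_bridge₁_self :
    cov[fun ω ↦ bridge₁ ω u, fun ω ↦ bridge₁ ω u; preWienerMeasure] = (u : ℝ) - (u : ℝ) ^ 2 := by
  rw [covariance_bridge₁, min_self]; ring

/-- `Cov(β_{w}, β_u) = u − u w` for the later time `w = u + (1−u)v'`. [folklore] -/
theorem covariance_bridge₁_sndTime_self (v : I) :
    cov[fun ω ↦ bridge₁ ω (sndTime u v), fun ω ↦ bridge₁ ω u; preWienerMeasure] =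
      (u : ℝ) - (u : ℝ) * (u + (1 - u) * v) := by
  have hle : (u : ℝ) ≤ u + (1 - u) * v := by nlinarith [u.2.1, u.2.2, v.2.1]
  rw [covariance_bridge₁, coe_sndTime, min_eq_right hle]
  ring

/-- `Cov(β_u, β_w) = u − u w`. [folklore] -/
theorem covariance_bridge₁_self_sndTime (v : I) :
    cov[fun ω ↦ bridge₁ ω u, fun ω ↦ bridge₁ ω (sndTime u v); preWienerMeasure] =
      (u : ℝ) - (u : ℝ) * (u + (1 - u) * v) := by
  haveI := isProbabilityMeasure_preWienerMeasure'
  rw [covariance_comm, covariance_bridge₁_sndTime_self]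

/-- `Cov(β_w, β_{w'}) = (w ∧ w') − w w'` with `w ∧ w' = u + (1−u)(v ∧ v')`. [folklore] -/
theorem covariance_bridge₁_sndTime (v v' : I) :
    cov[fun ω ↦ bridge₁ ω (sndTime u v), fun ω ↦ bridge₁ ω (sndTime u v'); preWienerMeasure] =
      ((u : ℝ) + (1 - u) * min (v : ℝ) v') - ((u : ℝ) + (1 - u) * v) * (u + (1 - u) * v') := by
  rw [covariance_bridge₁, coe_sndTime, coe_sndTime, min_add_add_left,
    ← mul_min_of_nonneg _ _ (sub_nonneg.2 u.2.2)]

/-- `Cov(β_{uv}, β_{w'}) = uv − uv w'` (the earlier time is `uv ≤ u ≤ w'`). [folklore] -/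
theorem covariance_bridge₁_fstTime_sndTime (v v' : I) :
    cov[fun ω ↦ bridge₁ ω (fstTime u v), fun ω ↦ bridge₁ ω (sndTime u v'); preWienerMeasure] =
      (u : ℝ) * v - (u : ℝ) * v * (u + (1 - u) * v') := by
  have hle : (u : ℝ) * v ≤ u + (1 - u) * v' := by
    nlinarith [u.2.1, u.2.2, v.2.1, v.2.2, v'.2.1, mul_le_of_le_one_right u.2.1 v.2.2]
  rw [covariance_bridge₁, coe_fstTime, coe_sndTime, min_eq_left hle]

/-- **`Cov(A_v, A_{v'}) = u (v ∧ v' − vv')`**: the first piece is a bridge of variance `u`.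
[folklore] -/
theorem covariance_splitFst (v v' : I) :
    cov[fun ω ↦ splitFst u ω v, fun ω ↦ splitFst u ω v'; preWienerMeasure] =
      (u : ℝ) * (min (v : ℝ) v' - (v : ℝ) * v') := by
  haveI := isProbabilityMeasure_preWienerMeasure'
  simp only [splitFst]
  rw [covariance_fun_sub_fun_sub (memLp_two_bridge₁ _) ((memLp_two_bridge₁ u).const_mul _)
    (memLp_two_bridge₁ _) ((memLp_two_bridge₁ u).const_mul _), covariance_const_mul_right,
    covariance_const_mul_left, covariance_const_mul_left, covariance_const_mul_right,
    covariance_bridge₁_fstTime, covariance_bridge₁_fstTime_self,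
    covariance_bridge₁_self_fstTime, covariance_bridge₁_self]
  ring

/-- **`Cov(C_v, C_{v'}) = (1 − u)(v ∧ v' − vv')`**: the second piece is a bridge of variance
`1 − u`. [folklore] -/
theorem covariance_splitSnd (v v' : I) :
    cov[fun ω ↦ splitSnd u ω v, fun ω ↦ splitSnd u ω v'; preWienerMeasure] =
      (1 - (u : ℝ)) * (min (v : ℝ) v' - (v : ℝ) * v') := by
  haveI := isProbabilityMeasure_preWienerMeasure'
  simp only [splitSnd]
  rw [covariance_fun_sub_fun_sub (memLp_two_bridge₁ _) ((memLp_two_bridge₁ u).const_mul _)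
    (memLp_two_bridge₁ _) ((memLp_two_bridge₁ u).const_mul _), covariance_const_mul_right,
    covariance_const_mul_left, covariance_const_mul_left, covariance_const_mul_right,
    covariance_bridge₁_sndTime, covariance_bridge₁_sndTime_self,
    covariance_bridge₁_self_sndTime, covariance_bridge₁_self]
  ring

/-- **`Cov(A_v, C_{v'}) = 0`**. [folklore] -/
theorem covariance_splitFst_splitSnd (v v' : I) :
    cov[fun ω ↦ splitFst u ω v, fun ω ↦ splitSnd u ω v'; preWienerMeasure] = 0 := by
  haveI := isProbabilityMeasure_preWienerMeasure'
  simp only [splitFst, splitSnd]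
  rw [covariance_fun_sub_fun_sub (memLp_two_bridge₁ _) ((memLp_two_bridge₁ u).const_mul _)
    (memLp_two_bridge₁ _) ((memLp_two_bridge₁ u).const_mul _), covariance_const_mul_right,
    covariance_const_mul_left, covariance_const_mul_left, covariance_const_mul_right,
    covariance_bridge₁_fstTime_sndTime, covariance_bridge₁_fstTime_self,
    covariance_bridge₁_self_sndTime, covariance_bridge₁_self]
  ring

/-- **`Cov(A_v, β_u) = 0`**. [folklore] -/
theorem covariance_splitFst_bridge₁ (v : I) :
    cov[fun ω ↦ splitFst u ω v, fun ω ↦ bridge₁ ω u; preWienerMeasure] = 0 := by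
  haveI := isProbabilityMeasure_preWienerMeasure'
  simp only [splitFst]
  rw [covariance_fun_sub_left (memLp_two_bridge₁ _) ((memLp_two_bridge₁ u).const_mul _)
    (memLp_two_bridge₁ _), covariance_const_mul_left, covariance_bridge₁_fstTime_self,
    covariance_bridge₁_self]
  ring

/-- **`Cov(C_v, β_u) = 0`**. [folklore] -/
theorem covariance_splitSnd_bridge₁ (v : I) :
    cov[fun ω ↦ splitSnd u ω v, fun ω ↦ bridge₁ ω u; preWienerMeasure] = 0 := by
  haveI := isProbabilityMeasure_preWienerMeasure'
  simp only [splitSnd]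
  rw [covariance_fun_sub_left (memLp_two_bridge₁ _) ((memLp_two_bridge₁ u).const_mul _)
    (memLp_two_bridge₁ _), covariance_const_mul_left, covariance_bridge₁_sndTime_self,
    covariance_bridge₁_self]
  ring

end Covariance

/-! ### Laws of the pieces and independence -/

/-- The pieces are linear combinations of Brownian marginals: joint Gaussianity of
`(A_v)_v ∪ (C_v)_v ∪ {β_u}` (indexed by `I ⊕ (I ⊕ Unit)`). [folklore] -/
theorem isGaussianProcess_split (u : I) :
    IsGaussianProcess (Sum.elim (fun (v : I) ω ↦ splitFst u ω v)
      (Sum.elim (fun (v : I) ω ↦ splitSnd u ω v) (fun (_ : Unit) ω ↦ bridge₁ ω u)))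
      preWienerMeasure := by
  -- every member is `B_{t₁} + b B_u + c B_1`
  have h := isPreBrownianReal_brownian.isGaussianProcess.linearCombination₃
    (Sum.elim (fun v : I ↦ timeOf (fstTime u v))
      (Sum.elim (fun v : I ↦ timeOf (sndTime u v)) (fun _ : Unit ↦ timeOf u)))
    (fun _ ↦ timeOf u) (fun _ ↦ (1 : ℝ≥0)) (fun _ ↦ (1 : ℝ))
    (Sum.elim (fun v : I ↦ -(v : ℝ)) (Sum.elim (fun v : I ↦ -(1 - (v : ℝ))) (fun _ ↦ (0 : ℝ))))
    (Sum.elim (fun v : I ↦ -((u : ℝ) * v) + (v : ℝ) * u)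
      (Sum.elim (fun v : I ↦ -((u : ℝ) + (1 - u) * v) + (1 - (v : ℝ)) * u) (fun _ ↦ -(u : ℝ))))
  refine h.congr fun p ↦ Filter.Eventually.of_forall fun ω ↦ ?_
  rcases p with v | v | x
  · simp only [Sum.elim_inl, splitFst, bridge₁, coe_fstTime]; ring
  · simp only [Sum.elim_inr, Sum.elim_inl, splitSnd, bridge₁, coe_sndTime]; ring
  · simp only [Sum.elim_inr, bridge₁]; ring

/-- The first piece is a centred Gaussian process. [folklore] -/
theorem isGaussianProcess_splitFst (u : I) :
    IsGaussianProcess (fun (v : I) ω ↦ splitFst u ω v) preWienerMeasure := by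
  have h := (isGaussianProcess_split u).comp_right (Sum.inl : I → I ⊕ (I ⊕ Unit))
  exact h

/-- The second piece is a centred Gaussian process. [folklore] -/
theorem isGaussianProcess_splitSnd (u : I) :
    IsGaussianProcess (fun (v : I) ω ↦ splitSnd u ω v) preWienerMeasure := by
  have h := (isGaussianProcess_split u).comp_right
    (Sum.inr ∘ Sum.inl : I → I ⊕ (I ⊕ Unit))
  exact h

/-- The scaled bridge `c β` is a centred Gaussian process with covariance `c² (a ∧ b − ab)`.
[folklore] -/
theorem isGaussianProcess_const_mul_bridge₁ (c : ℝ) :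
    IsGaussianProcess (fun (v : I) ω ↦ c * bridge₁ ω v) preWienerMeasure := by
  have h := isPreBrownianReal_brownian.isGaussianProcess.linearCombination₃
    (fun v : I ↦ timeOf v) (fun _ ↦ (1 : ℝ≥0)) (fun _ ↦ (1 : ℝ≥0))
    (fun _ ↦ c) (fun v ↦ -(c * (v : ℝ))) (fun _ ↦ 0)
  refine h.congr fun v ↦ Filter.Eventually.of_forall fun ω ↦ ?_
  simp only [bridge₁]; ring

/-- **The first piece has the law of `√u · β`** (a Brownian bridge of variance `u`): equal
covariances of centred Gaussian processes (Kallenberg Lemma 13.1). [cite: Kallenberg2002, Lemma 13.1] -/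
theorem map_splitFst (u : I) :
    preWienerMeasure.map (fun ω (v : I) ↦ splitFst u ω v) =
      preWienerMeasure.map (fun ω (v : I) ↦ Real.sqrt u * bridge₁ ω v) := by
  haveI := isProbabilityMeasure_preWienerMeasure'
  refine (isGaussianProcess_splitFst u).map_eq_of_covariance_eq
    (isGaussianProcess_const_mul_bridge₁ _) (fun v ↦ ?_) (fun v v' ↦ ?_) ?_ ?_
  · change ∫ ω, splitFst u ω v ∂preWienerMeasure = ∫ ω, Real.sqrt u * bridge₁ ω v ∂preWienerMeasure
    simp only [splitFst]
    rw [integral_sub (integrable_bridge₁ _) ((integrable_bridge₁ u).const_mul _),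
      integral_const_mul, integral_const_mul]
    change preWienerMeasure[fun ω ↦ bridge₁ ω (fstTime u v)] - _ = _
    rw [integral_bridge₁]
    change (0 : ℝ) - (v : ℝ) * preWienerMeasure[fun ω ↦ bridge₁ ω u] =
      Real.sqrt u * preWienerMeasure[fun ω ↦ bridge₁ ω v]
    rw [integral_bridge₁, integral_bridge₁, mul_zero, mul_zero, sub_zero]
  · rw [covariance_splitFst, covariance_const_mul_left, covariance_const_mul_right,
      covariance_bridge₁, ← mul_assoc, Real.mul_self_sqrt u.2.1]
  · exact (measurable_pi_lambda _ fun v ↦ measurable_splitFst u v).aemeasurable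
  · exact (measurable_pi_lambda _ fun v ↦ (measurable_bridge₁ v).const_mul _).aemeasurable

/-- **The second piece has the law of `√(1−u) · β`** (a Brownian bridge of variance `1 − u`).
[cite: Kallenberg2002, Lemma 13.1] -/
theorem map_splitSnd (u : I) :
    preWienerMeasure.map (fun ω (v : I) ↦ splitSnd u ω v) =
      preWienerMeasure.map (fun ω (v : I) ↦ Real.sqrt (1 - u) * bridge₁ ω v) := by
  haveI := isProbabilityMeasure_preWienerMeasure'
  refine (isGaussianProcess_splitSnd u).map_eq_of_covariance_eq
    (isGaussianProcess_const_mul_bridge₁ _) (fun v ↦ ?_) (fun v v' ↦ ?_) ?_ ?_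
  · change ∫ ω, splitSnd u ω v ∂preWienerMeasure =
      ∫ ω, Real.sqrt (1 - u) * bridge₁ ω v ∂preWienerMeasure
    simp only [splitSnd]
    rw [integral_sub (integrable_bridge₁ _) ((integrable_bridge₁ u).const_mul _),
      integral_const_mul, integral_const_mul]
    change preWienerMeasure[fun ω ↦ bridge₁ ω (sndTime u v)] - _ = _
    rw [integral_bridge₁]
    change (0 : ℝ) - (1 - (v : ℝ)) * preWienerMeasure[fun ω ↦ bridge₁ ω u] =
      Real.sqrt (1 - u) * preWienerMeasure[fun ω ↦ bridge₁ ω v]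
    rw [integral_bridge₁, integral_bridge₁, mul_zero, mul_zero, sub_zero]
  · rw [covariance_splitSnd, covariance_const_mul_left, covariance_const_mul_right,
      covariance_bridge₁, ← mul_assoc, Real.mul_self_sqrt (sub_nonneg.2 u.2.2)]
  · exact (measurable_pi_lambda _ fun v ↦ measurable_splitSnd u v).aemeasurable
  · exact (measurable_pi_lambda _ fun v ↦ (measurable_bridge₁ v).const_mul _).aemeasurable

/-- **The first piece is independent of (second piece, splitting value)**: `A ⟂ (C, β_u)`
(jointly Gaussian, all cross-covariances vanish). [cite: Kallenberg2002, Lemma 13.1] -/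
theorem indepFun_splitFst_splitSnd_bridge₁ (u : I) :
    IndepFun (fun ω (v : I) ↦ splitFst u ω v)
      (fun ω (p : I ⊕ Unit) ↦ Sum.elim (fun v ↦ splitSnd u ω v) (fun _ ↦ bridge₁ ω u) p)
      preWienerMeasure := by
  have hm : ∀ p : I ⊕ Unit, AEMeasurable (Sum.elim (fun (v : I) ω ↦ splitSnd u ω v)
      (fun (_ : Unit) ω ↦ bridge₁ ω u) p) preWienerMeasure := by
    rintro (v | x)
    · exact (measurable_splitSnd u v).aemeasurable
    · exact (measurable_bridge₁ u).aemeasurable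
  have hc : ∀ (v : I) (p : I ⊕ Unit), cov[fun ω ↦ splitFst u ω v, Sum.elim
      (fun (v : I) ω ↦ splitSnd u ω v) (fun (_ : Unit) ω ↦ bridge₁ ω u) p; preWienerMeasure] = 0 := by
    rintro v (v' | x)
    · exact covariance_splitFst_splitSnd u v v'
    · exact covariance_splitFst_bridge₁ u v
  have h := (isGaussianProcess_split u).indepFun_of_covariance_eq_zero
    (fun v ↦ (measurable_splitFst u v).aemeasurable) hm hc
  have e : (fun ω (p : I ⊕ Unit) ↦ Sum.elim (fun v ↦ splitSnd u ω v) (fun _ ↦ bridge₁ ω u) p) =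
      fun ω t ↦ Sum.elim (fun (v : I) ω ↦ splitSnd u ω v) (fun (_ : Unit) ω ↦ bridge₁ ω u) t ω := by
    funext ω p
    rcases p with v | x <;> rfl
  rw [e]
  exact h

/-- **The second piece is independent of the splitting value**: `C ⟂ β_u`.
[cite: Kallenberg2002, Lemma 13.1] -/
theorem indepFun_splitSnd_bridge₁ (u : I) :
    IndepFun (fun ω (v : I) ↦ splitSnd u ω v) (fun ω ↦ bridge₁ ω u) preWienerMeasure := by
  have hG : IsGaussianProcess (Sum.elim (fun (v : I) ω ↦ splitSnd u ω v)
      (fun (_ : Unit) ω ↦ bridge₁ ω u)) preWienerMeasure :=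
    (isGaussianProcess_split u).comp_right (Sum.inr : I ⊕ Unit → I ⊕ (I ⊕ Unit))
  have h := hG.indepFun_of_covariance_eq_zero (fun v ↦ (measurable_splitSnd u v).aemeasurable)
    (fun _ ↦ (measurable_bridge₁ u).aemeasurable) (fun v _ ↦ covariance_splitSnd_bridge₁ u v)
  have h2 : (fun ω ↦ bridge₁ ω u : (ℝ≥0 → ℝ) → ℝ) =
      (fun g : Unit → ℝ ↦ g ()) ∘ fun ω (_ : Unit) ↦ bridge₁ ω u := rfl
  rw [h2]
  exact h.comp measurable_id (measurable_pi_apply ())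

/-- The whole bridge is recovered from the pieces and the splitting value (before `u`):
`β_{uv} = A_v + v β_u`. [folklore] -/
theorem bridge₁_fstTime (u v : I) (ω : ℝ≥0 → ℝ) :
    bridge₁ ω (fstTime u v) = splitFst u ω v + (v : ℝ) * bridge₁ ω u := by
  rw [splitFst, sub_add_cancel]

/-- The whole bridge is recovered from the pieces and the splitting value (after `u`):
`β_{u+(1−u)v} = C_v + (1 − v) β_u`. [folklore] -/
theorem bridge₁_sndTime (u v : I) (ω : ℝ≥0 → ℝ) :
    bridge₁ ω (sndTime u v) = splitSnd u ω v + (1 - (v : ℝ)) * bridge₁ ω u := by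
  rw [splitSnd, sub_add_cancel]

end BrownianLoop

end Literature.Probability.RandomPlanarGeometry

end
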